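/-
Copyright (c) 2026 the pub-hodgecm-mathlib formalisation cell (harness21).  Prover seat hodgecm-mathlib-K2E1-p13 (g4), Track B ∕ K2-LIT, h413 = `stmt-HodgeConjecture-24833`,
R90-TF section S8 «ContSpec-n½», #2 chain (G side), deal S8-R72∕R79 of R90-CS-plan (g2), (XF)₃ sub-cut C3 (census `R90/S8/CENSUS-XF3.K2E1-p13-g4.md`): the TORUS-LEVEL split of
the `B(F)`-weighted bracket of two twisted pseudo-Eisenstein series of `U(2,1)` into its `w = 1` and `w = w₀` terms, each a torus character `η_w(t)` times a radial factor.
-/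
import Summits.HodgeConjecture.HodgeConjecture.Theorems.K2E1ChiSectionTorusAverageU3            -- ★ C1 p862808 (this seat): pair sections along `t·K_U`, `w = 1` `K_U`-average, torus scaling; brings ★ row 4a
import Summits.HodgeConjecture.HodgeConjecture.Theorems.K2E1ChiPseudoEisensteinRadialCMThree     -- ★ C2 p862856 (this seat): `θ_{f,ψ}` on `U(2,1)`: bounded, Borel, constant term
import Summits.HodgeConjecture.HodgeConjecture.Theorems.K2E1PseudoEisensteinInnerProductCMTwoFinal  -- ★ Final §1 `setLIntegral_inv_mul_inv_mul_enorm_lt_top`; brings ★ C `setLIntegral_inv_ideleNorm_mul_comp_eq`, ★ D0 `exists_one_le_forall_eq_zero`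
import Literature.NumberTheory.Automorphic.UnitaryGroupBorelHeightContinuous                     -- ★ `measurable_borelHeight`
import Summits.HodgeConjecture.HodgeConjecture.Theorems.K2E1IntertwinedCoeffContinuousCM          -- ★ `integrable_borelHeight_weylLongU_mul_rpow_cm_three` (Godement, `σ > 2`), `borelHeight_weylLongU_coe_le_one`
import Literature.NumberTheory.Automorphic.UnitaryGroupTorusThreeRay                             -- ★ `exists_torus_diagUnit_eq`, `continuous_diagUnit_torus`
import HarnessLib

/-!
# (XF)₃ C3 — `K2E1ChiPseudoEisensteinIdeleSplitCMThree`: THE `w₀`-CELL OF A TWISTED PSEUDO-EISENSTEIN CONSTANT TERM ALONG THE TORUS OF `U(J₃)` —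
# `∫_{N(𝔸)} f(H(w₀ v t y))·φ(w₀ v t y) dν(v) = δ_B(t)·χ₁ʷ(d₀ t)·χ₂(t₁₁)·∫_{N(𝔸)} f(‖d₀ t‖⁻¹·H(w₀ v y))·φ(w₀ v y) dν(v)` for a GENERAL profile `f` (no Mellin transform), and the
# resulting TORUS CHARACTERS `η_1 = (χ₁conj χ₁′)∘d₀·(χ₂conj χ₂′)∘(·)₁₁`, `η_{w₀} = (χ₁conj χ₁′ʷ)∘d₀·(χ₂conj χ₂′)∘(·)₁₁` of the two terms of the bracket's `K_U`-average

Track B ∕ K2-LIT, crux h413 = `stmt-HodgeConjecture-24833`, route of record `HCCMUnconditional`; cell `hodgecm-mathlib`, R90-TF programme, section S8 «ContSpec-n½», #2 chain, letter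
(XF)₃ of ★ `K2E1ChiPseudoEisensteinFamiliesOrthogonalCMThree` (CLOSURE TARGET R90_CLOSURE_DAG row T2.1; xref E2.G8.R1 (δ)).  THEOREMS ONLY (no `def`, no `instance`, no `notation`,
no named-fact hypothesis, no `sorry`; default heartbeats); lane `--supports stmt-HodgeConjecture-24833 --as helper` (count-neutral).  Pays no socket (sub-cut C3 of C1–C4).

THE MATHEMATICS ([MoeglinWaldspurger1995] II.1.6–II.1.7, II.2.1; [Rogawski1990] §7.3 pp. 96–98).  KEY POINT (census refinement): for the VANISHING (XF)₃ no Mellin form of the `w₀`-cell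
is needed.  Along the torus, `w₀ v (t y) = (w₀ t w₀⁻¹)·(w₀ (t⁻¹vt) y)`, `w₀ t w₀⁻¹ = diag(d₂, t₁₁, d₀)` with `d₂ = c(d₀)⁻¹`, so for a `(χ₁,χ₂)`-pair-section `φ` and ANY profile `f`:
`φ(w₀ v t y) = χ₁(d₂)χ₂(t₁₁)·φ(w₀ v′ y)` (★ row 4a `apply_weylLongU_torus_mul_of_isChiSectionPair`, `χ₁(d₂) = χ₁ʷ(d₀)` ★), `H(w₀ v t y) = ‖d₀‖⁻¹·H(w₀ v′ y)` (★
`borelHeight_weylLongU_mul_diag_mul`), `dν(v) = δ_B(t) dν(v′)` (★ `map_torusConj_eq_torusRootModulus_smul`).  Hence §1: the `w₀`-cell of the constant term of `θ_{f′,φ′}` (★ C2) is, along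
`t·K_U`, the torus character `χ₁′ʷ(d₀ t)·χ₂′(t₁₁)` times a function of `‖d₀ t‖` and `k` only; §2 assembles the two `K_U`-averages of the bracket integrand
`Ψ = (f∘H)φ·conj((θ_{f′,φ′})_B)` along `t·K_U` (★ C1 §3 for `w = 1`, §1 for `w = w₀`): `∫_{K_U} Ψ(t k) dμ_K = η_1(t)·R₁(‖d₀t‖) + η_{w₀}(t)·R₂(‖d₀t‖)` with EXPLICIT radial factors
`R₁, R₂` and the torus characters of the title — the input shape of the dichotomy of C4 (★ R6f(i) on the `U(1)`-fibre when `χ₂ ≠ χ₂′`, ★ (δ) push + ★ GR-χ Lemma B on `d₀` otherwise).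
* §1 **`integral_comp_borelHeight_mul_weylLongU_torus_mul_of_isChiSectionPair`** (general profile, `d`-currency), `…_eq_diagUnit` (`d₀`-currency: `δ_B = ‖d₀‖²`, `χ₁(d₂) = χ₁ʷ(d₀)`).
* §2 **`integral_maximalCompact_torus_bracket_eq_two_terms`** — the `K_U`-average of `Ψ` along `t·K_U` as `η_1·R₁ + η_{w₀}·R₂`.
HONEST SCOPE: the `B(F)`-weight ∕ Weil front end (`⟨[θ],[θ′]⟩ = c_μ∫β•(θ·conj θ′)`, AVG₃ ★) and the dichotomy are C4; the Mellin∕Plancherel EVALUATION of the surviving terms (needed for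
(OD)∕(SD), not for (XF)) is not on this road.
HONEST LABEL: HC_CM is proved only modulo the 7 printed citations (2 remaining named inputs: hLiu418 = `stmt-HodgeConjecture-24832`, h413 = `stmt-HodgeConjecture-24833`) until rung 0
closes; REL ≠ ★ ≠ BUILT; this file asserts no named fact and closes no socket; count-neutral; letter-free.

## References
* [MoeglinWaldspurger1995] C. Mœglin, J.-L. Waldspurger, *Spectral Decomposition and Eisenstein Series* (1995), II.1.6–II.1.7, II.2.1.
* [Rogawski1990] J. D. Rogawski, *Automorphic Representations of Unitary Groups in Three Variables* (1990), §1.10 p. 9, §2.2 p. 13, §7.3 pp. 96–98.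
* [Garrett2018] P. Garrett, *Modern Analysis of Automorphic Forms by Example* (2018), §2.8.
-/

set_option autoImplicit false
set_option linter.dupNamespace false  -- the mandated namespace repeats the summit's segment (`HodgeConjecture.HodgeConjecture`)

noncomputable section

open MeasureTheory Measure NumberField IsDedekindDomain Matrix
open scoped ENNReal NNReal MatrixGroups ComplexConjugate
open Literature.NumberTheory Literature.NumberTheory.Automorphic Literature.NumberTheory.Automorphic.UnitaryGroup AdelicGroupData
open Literature.NumberTheory.GaloisRepresentations (HeckeCharacter ideleGroup)
open Literature.NumberTheory.Automorphic.Arthur2013.Leaves.TECR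
open Summit.HodgeConjecture.HodgeConjecture.Cruxes.H413.K2E1BorelEisensteinU
open Summit.HodgeConjecture.HodgeConjecture.Cruxes.H413.K2E1CharacterEisensteinU2Defs
open Summit.HodgeConjecture.HodgeConjecture.Cruxes.H413.K2E1CharacterEisensteinU3PairDefs
open Summit.HodgeConjecture.HodgeConjecture.Cruxes.H413.K2E1ChiIntertwinedSectionU3 (apply_weylLongU_torus_mul_of_isChiSectionPair chi_torus_last_eq_reflectChar middleEntryUnitary_eq_of_apply_eq)
open Summit.HodgeConjecture.HodgeConjecture.Cruxes.H413.K2E1IntertwiningGrowthU3 (borelHeight_weylLongU_mul_diag_mul)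
open Summit.HodgeConjecture.HodgeConjecture.Cruxes.H413.K2E1EisensteinPairingUnfolded (torusRootModulus_diagUnit_torus_eq_ideleNorm_mul)
open Summit.HodgeConjecture.HodgeConjecture.Cruxes.H413.K2E1ChiSectionTorusAverageU3
open Summit.HodgeConjecture.HodgeConjecture.Cruxes.H413.K2E1PseudoEisensteinRadialCMTwo (exists_one_le_forall_eq_zero)
open Summit.HodgeConjecture.HodgeConjecture.Cruxes.H413.K2E1IdeleClassRadialIntegralCM (setIntegral_inv_ideleNorm_smul_comp_eq setLIntegral_inv_ideleNorm_mul_comp_eq)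
open Summit.HodgeConjecture.HodgeConjecture.Cruxes.H413.K2E1PseudoEisensteinInnerProductCMTwoFinal (setLIntegral_inv_mul_inv_mul_enorm_lt_top)
open Summit.HodgeConjecture.HodgeConjecture.Cruxes.H413.K2E1IntertwinedCoeffContinuousCM (integrable_borelHeight_weylLongU_mul_rpow_cm_three)

namespace Summit.HodgeConjecture.HodgeConjecture.Cruxes.H413.K2E1ChiPseudoEisensteinIdeleSplitCMThree

variable {F E : Type} [Field F] [NumberField F] [Field E] [NumberField E] [Algebra F E] {c : E ≃ₐ[F] E}
variable [MeasurableSpace (quasiSplit F E c 3).Adelic] [BorelSpace (quasiSplit F E c 3).Adelic]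

/-! ## §1 The `w₀`-cell along the torus, GENERAL profile -/

/-- **`∫ f(H(W v (t x)))·φ(W v (t x)) dν(v) = δ_B(t)·χ₁(d₂)χ₂(t₁₁)·∫ f(‖d₀‖⁻¹·H(W v x))·φ(W v x) dν(v)`** for a Borel `(χ₁, χ₂)`-pair-section `φ`, a Borel profile `f : ℝ → ℂ`, a Haar `ν` on
`N(𝔸)`, `t = diag(d) ∈ T(𝔸_F)`, every `x` (substitute `v = t u t⁻¹`, ★ `map_torusConj_eq_torusRootModulus_smul`; then pointwise ★ `apply_weylLongU_torus_mul_of_isChiSectionPair` and ★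
`borelHeight_weylLongU_mul_diag_mul`).  No convergence hypothesis (both sides are Bochner integrals of the same shape).  General-profile twin of ★ row 4a
`integral_flatSectionU_weylLongU_torus_mul_of_isChiSectionPair`. [cite: MoeglinWaldspurger1995, II.1.6] [cite: Garrett2018, §2.8] -/
theorem integral_comp_borelHeight_mul_weylLongU_torus_mul_of_isChiSectionPair (hc : c * c = 1) (hc1 : c ≠ 1) (ν : Measure ↥(adelicUnipotent F E c 3)) [ν.IsHaarMeasure]
    {χ₁ : HeckeCharacter E} {χ₂ : ↥(TorusDict.torus c) →ₜ* ℂˣ} {φ : (quasiSplit F E c 3).Adelic → ℂ} (hφ : IsChiSectionPair χ₁ χ₂ φ) (hφm : Measurable φ)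
    {f : ℝ → ℂ} (hfm : Measurable f)
    (t : ↥(torusInBorel F E c 3)) {d : Fin 3 → (AdeleRing (𝓞 E) E)ˣ}
    (hd : glDiagonal 3 (AdeleRing (𝓞 E) E) d = adelicVal F E c 3 _ ((t : borelAdelic F E c 3) : (quasiSplit F E c 3).Adelic)) (x : (quasiSplit F E c 3).Adelic) :
    ∫ v : ↥(adelicUnipotent F E c 3),
        f (borelHeight ((quasiSplit F E c 3).toAdelic (weylLongU (c : E →+* E) (rfl : (StdForm.antidiagonal 3).over E = (StdForm.antidiagonal 3).over E)) *
            ((v : (quasiSplit F E c 3).Adelic) * (((t : borelAdelic F E c 3) : (quasiSplit F E c 3).Adelic) * x))) : ℝ) *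
          φ ((quasiSplit F E c 3).toAdelic (weylLongU (c : E →+* E) (rfl : (StdForm.antidiagonal 3).over E = (StdForm.antidiagonal 3).over E)) *
            ((v : (quasiSplit F E c 3).Adelic) * (((t : borelAdelic F E c 3) : (quasiSplit F E c 3).Adelic) * x))) ∂ν =
      ((torusRootModulus E 3 d : ℝ) : ℂ) * (((χ₁ (d 2) : ℂˣ) : ℂ) * ((χ₂ (middleEntryUnitary (t : borelAdelic F E c 3).2) : ℂˣ) : ℂ)) *
        ∫ v : ↥(adelicUnipotent F E c 3),
          f ((((IdeleClassGroup.ideleNorm E (d 0))⁻¹ *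
              borelHeight ((quasiSplit F E c 3).toAdelic (weylLongU (c : E →+* E) (rfl : (StdForm.antidiagonal 3).over E = (StdForm.antidiagonal 3).over E)) *
                ((v : (quasiSplit F E c 3).Adelic) * x)) : ℝ≥0) : ℝ)) *
            φ ((quasiSplit F E c 3).toAdelic (weylLongU (c : E →+* E) (rfl : (StdForm.antidiagonal 3).over E = (StdForm.antidiagonal 3).over E)) *
              ((v : (quasiSplit F E c 3).Adelic) * x)) ∂ν := by
  haveI := locallyCompactSpace_adeleRing' E
  letI : MeasurableSpace (AdeleRing (𝓞 E) E) := borel _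
  haveI : BorelSpace (AdeleRing (𝓞 E) E) := ⟨rfl⟩
  set T : (quasiSplit F E c 3).Adelic := ((t : borelAdelic F E c 3) : (quasiSplit F E c 3).Adelic) with hT
  set W : (quasiSplit F E c 3).Adelic := (quasiSplit F E c 3).toAdelic (weylLongU (c : E →+* E) (rfl : (StdForm.antidiagonal 3).over E = (StdForm.antidiagonal 3).over E)) with hW
  -- the integrand as a function of `u = t⁻¹ v t`
  set Φ : ↥(adelicUnipotent F E c 3) → ℂ := fun u => f (borelHeight (W * (T * ((u : (quasiSplit F E c 3).Adelic) * x))) : ℝ) * φ (W * (T * ((u : (quasiSplit F E c 3).Adelic) * x))) with hΦ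
  have hcont : Continuous fun u : ↥(adelicUnipotent F E c 3) => W * (T * ((u : (quasiSplit F E c 3).Adelic) * x)) :=
    continuous_const.mul (continuous_const.mul (continuous_subtype_val.mul continuous_const))
  have hΦm : Measurable Φ :=
    ((hfm.comp (measurable_coe_nnreal_real.comp (measurable_borelHeight.comp hcont.measurable))).mul (hφm.comp hcont.measurable))
  have hκ : Measurable fun u : ↥(adelicUnipotent F E c 3) => (⟨T⁻¹ * (u : (quasiSplit F E c 3).Adelic) * T,
      conj_mem_adelicUnipotent (t : borelAdelic F E c 3).2 u.2⟩ : ↥(adelicUnipotent F E c 3)) :=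
    ((continuous_const.mul continuous_subtype_val).mul continuous_const).measurable.subtype_mk
  have h1 : (fun v : ↥(adelicUnipotent F E c 3) => f (borelHeight (W * ((v : (quasiSplit F E c 3).Adelic) * (T * x))) : ℝ) * φ (W * ((v : (quasiSplit F E c 3).Adelic) * (T * x)))) =
      fun v : ↥(adelicUnipotent F E c 3) => Φ (⟨T⁻¹ * (v : (quasiSplit F E c 3).Adelic) * T, conj_mem_adelicUnipotent (t : borelAdelic F E c 3).2 v.2⟩ : ↥(adelicUnipotent F E c 3)) := by
    funext v
    simp only [hΦ]
    rw [show T * (T⁻¹ * (v : (quasiSplit F E c 3).Adelic) * T * x) = (v : (quasiSplit F E c 3).Adelic) * (T * x) by group]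
  have h2 : ∀ u : ↥(adelicUnipotent F E c 3), Φ u = (((χ₁ (d 2) : ℂˣ) : ℂ) * ((χ₂ (middleEntryUnitary (t : borelAdelic F E c 3).2) : ℂˣ) : ℂ)) *
      (f ((((IdeleClassGroup.ideleNorm E (d 0))⁻¹ * borelHeight (W * ((u : (quasiSplit F E c 3).Adelic) * x))) : ℝ≥0) : ℝ) * φ (W * ((u : (quasiSplit F E c 3).Adelic) * x))) := fun u => by
    simp only [hΦ]
    rw [apply_weylLongU_torus_mul_of_isChiSectionPair hφ t hd, borelHeight_weylLongU_mul_diag_mul hd]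
    ring
  rw [h1, ← integral_map hκ.aemeasurable hΦm.aestronglyMeasurable, map_torusConj_eq_torusRootModulus_smul hc hc1 ν t hd, integral_smul_measure, ENNReal.coe_toReal]
  simp_rw [h2]
  rw [integral_const_mul, Complex.real_smul]
  ring

/-- **THE SAME IN `d₀`-CURRENCY** (`d = diagUnit t`, `δ_B(t) = ‖d₀‖·‖d₀‖`, `χ₁(d₂) = χ₁ʷ(d₀)`): the `w₀`-cell of the constant term of `θ_{f,φ}` along `t·(·)` carries the torus character
`χ₁ʷ(d₀ t)·χ₂(t₁₁)` and otherwise depends on `t` only through `‖d₀ t‖`. [cite: MoeglinWaldspurger1995, II.1.6] [cite: Rogawski1990, §7.3] -/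
theorem integral_comp_borelHeight_mul_weylLongU_torus_mul_eq_diagUnit (hc : c * c = 1) (hc1 : c ≠ 1) (ν : Measure ↥(adelicUnipotent F E c 3)) [ν.IsHaarMeasure]
    {χ₁ : HeckeCharacter E} {χ₂ : ↥(TorusDict.torus c) →ₜ* ℂˣ} {φ : (quasiSplit F E c 3).Adelic → ℂ} (hφ : IsChiSectionPair χ₁ χ₂ φ) (hφm : Measurable φ)
    {f : ℝ → ℂ} (hfm : Measurable f) (t : ↥(torusInBorel F E c 3)) (x : (quasiSplit F E c 3).Adelic) :
    ∫ v : ↥(adelicUnipotent F E c 3),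
        f (borelHeight ((quasiSplit F E c 3).toAdelic (weylLongU (c : E →+* E) (rfl : (StdForm.antidiagonal 3).over E = (StdForm.antidiagonal 3).over E)) *
            ((v : (quasiSplit F E c 3).Adelic) * (((t : borelAdelic F E c 3) : (quasiSplit F E c 3).Adelic) * x))) : ℝ) *
          φ ((quasiSplit F E c 3).toAdelic (weylLongU (c : E →+* E) (rfl : (StdForm.antidiagonal 3).over E = (StdForm.antidiagonal 3).over E)) *
            ((v : (quasiSplit F E c 3).Adelic) * (((t : borelAdelic F E c 3) : (quasiSplit F E c 3).Adelic) * x))) ∂ν =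
      (((IdeleClassGroup.ideleNorm E (diagUnit (t : borelAdelic F E c 3).2 0) : ℝ≥0) : ℝ) : ℂ) * (((IdeleClassGroup.ideleNorm E (diagUnit (t : borelAdelic F E c 3).2 0) : ℝ≥0) : ℝ) : ℂ) *
        (((reflectChar c χ₁ (diagUnit (t : borelAdelic F E c 3).2 0) : ℂˣ) : ℂ) * ((χ₂ (middleEntryUnitary (t : borelAdelic F E c 3).2) : ℂˣ) : ℂ)) *
        ∫ v : ↥(adelicUnipotent F E c 3),
          f ((((IdeleClassGroup.ideleNorm E (diagUnit (t : borelAdelic F E c 3).2 0))⁻¹ *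
              borelHeight ((quasiSplit F E c 3).toAdelic (weylLongU (c : E →+* E) (rfl : (StdForm.antidiagonal 3).over E = (StdForm.antidiagonal 3).over E)) *
                ((v : (quasiSplit F E c 3).Adelic) * x)) : ℝ≥0) : ℝ)) *
            φ ((quasiSplit F E c 3).toAdelic (weylLongU (c : E →+* E) (rfl : (StdForm.antidiagonal 3).over E = (StdForm.antidiagonal 3).over E)) *
              ((v : (quasiSplit F E c 3).Adelic) * x)) ∂ν := by
  have hd := glDiagonal_diagUnit_torus (F := F) (E := E) (c := c) (N := 3) t
  rw [integral_comp_borelHeight_mul_weylLongU_torus_mul_of_isChiSectionPair hc hc1 ν hφ hφm hfm t hd x, torusRootModulus_diagUnit_torus_eq_ideleNorm_mul,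
    chi_torus_last_eq_reflectChar χ₁ t hd, NNReal.coe_mul, Complex.ofReal_mul]

/-! ## §2 The `K_U`-average of the `w₀` term of the bracket along `t·K_U`: `η(t)·Φ₂(d₀ t)` -/

/-- **THE `w₀` TERM ALONG `t·K_U`**: for pair sections `φ ∈ (χ₁,χ₂)`, `φ′ ∈ (χ₁′,χ₂′)` (`φ′` Borel), profiles `g₁` and Borel `f′`, a real constant `κ` and `t ∈ T(𝔸_F)`:
`∫_{K_U} g₁(H(tk))·φ(tk)·conj(κ • ∫_{N(𝔸)} f′(H(W v (t k)))·φ′(W v (t k)) dν) dμ_K = (χ₂·conj χ₂′)(t₁₁) · (χ₁·conj χ₁′ʷ)(d₀ t) · (g₁(‖d₀t‖)·‖d₀t‖²) · ∫_{K_U} φ(k)·conj(κ • ∫_{N(𝔸)}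
f′(‖d₀t‖⁻¹H(W v k))·φ′(W v k) dν) dμ_K` (flat product) — the torus character `η = (χ₂ conj χ₂′)∘(·)₁₁` times a function of `d₀ t` (§1 + ★ C1 §1).  No convergence hypothesis. [cite: MoeglinWaldspurger1995, II.2.1]
[cite: Rogawski1990, §7.3 pp. 96–98] -/
theorem integral_maximalCompact_torus_chiSectionPair_mul_conj_wZero (hc : c * c = 1) (hc1 : c ≠ 1) (ν : Measure ↥(adelicUnipotent F E c 3)) [ν.IsHaarMeasure]
    (μK : Measure ((standardMaximalCompactGL 3 E).comap (adelicVal F E c 3 ((StdForm.antidiagonal 3).over E)) : Subgroup (quasiSplit F E c 3).Adelic))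
    {χ₁ χ₁' : HeckeCharacter E} {χ₂ χ₂' : ↥(TorusDict.torus c) →ₜ* ℂˣ} {φ φ' : (quasiSplit F E c 3).Adelic → ℂ} (hφ : IsChiSectionPair χ₁ χ₂ φ) (hφ' : IsChiSectionPair χ₁' χ₂' φ') (hφ'm : Measurable φ')
    (g₁ : ℝ → ℂ) {f' : ℝ → ℂ} (hf'm : Measurable f') (κ : ℝ) (t : ↥(torusInBorel F E c 3)) :
    ∫ k : ((standardMaximalCompactGL 3 E).comap (adelicVal F E c 3 ((StdForm.antidiagonal 3).over E)) : Subgroup (quasiSplit F E c 3).Adelic),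
        g₁ (borelHeight (((t : borelAdelic F E c 3) : (quasiSplit F E c 3).Adelic) * (k : (quasiSplit F E c 3).Adelic)) : ℝ) * φ (((t : borelAdelic F E c 3) : (quasiSplit F E c 3).Adelic) * (k : (quasiSplit F E c 3).Adelic)) *
          conj (κ • ∫ v : ↥(adelicUnipotent F E c 3),
            f' (borelHeight ((quasiSplit F E c 3).toAdelic (weylLongU (c : E →+* E) (rfl : (StdForm.antidiagonal 3).over E = (StdForm.antidiagonal 3).over E)) * (v : (quasiSplit F E c 3).Adelic) *
                (((t : borelAdelic F E c 3) : (quasiSplit F E c 3).Adelic) * (k : (quasiSplit F E c 3).Adelic))) : ℝ) *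
              φ' ((quasiSplit F E c 3).toAdelic (weylLongU (c : E →+* E) (rfl : (StdForm.antidiagonal 3).over E = (StdForm.antidiagonal 3).over E)) * (v : (quasiSplit F E c 3).Adelic) *
                (((t : borelAdelic F E c 3) : (quasiSplit F E c 3).Adelic) * (k : (quasiSplit F E c 3).Adelic))) ∂ν) ∂μK =
      (((χ₂ (middleEntryUnitary (t : borelAdelic F E c 3).2) : ℂˣ) : ℂ) * conj (((χ₂' (middleEntryUnitary (t : borelAdelic F E c 3).2) : ℂˣ) : ℂ))) *
        (((χ₁ (diagUnit (t : borelAdelic F E c 3).2 0) : ℂˣ) : ℂ) * conj (((reflectChar c χ₁' (diagUnit (t : borelAdelic F E c 3).2 0) : ℂˣ) : ℂ))) *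
          (g₁ ((IdeleClassGroup.ideleNorm E (diagUnit (t : borelAdelic F E c 3).2 0)) : ℝ) *
            ((((IdeleClassGroup.ideleNorm E (diagUnit (t : borelAdelic F E c 3).2 0) : ℝ≥0) : ℝ) : ℂ) * (((IdeleClassGroup.ideleNorm E (diagUnit (t : borelAdelic F E c 3).2 0) : ℝ≥0) : ℝ) : ℂ))) *
            ∫ k : ((standardMaximalCompactGL 3 E).comap (adelicVal F E c 3 ((StdForm.antidiagonal 3).over E)) : Subgroup (quasiSplit F E c 3).Adelic),
              φ (k : (quasiSplit F E c 3).Adelic) * conj (κ • ∫ v : ↥(adelicUnipotent F E c 3),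
                f' ((((IdeleClassGroup.ideleNorm E (diagUnit (t : borelAdelic F E c 3).2 0))⁻¹ *
                    borelHeight ((quasiSplit F E c 3).toAdelic (weylLongU (c : E →+* E) (rfl : (StdForm.antidiagonal 3).over E = (StdForm.antidiagonal 3).over E)) *
                      ((v : (quasiSplit F E c 3).Adelic) * (k : (quasiSplit F E c 3).Adelic))) : ℝ≥0) : ℝ)) *
                  φ' ((quasiSplit F E c 3).toAdelic (weylLongU (c : E →+* E) (rfl : (StdForm.antidiagonal 3).over E = (StdForm.antidiagonal 3).over E)) *
                    ((v : (quasiSplit F E c 3).Adelic) * (k : (quasiSplit F E c 3).Adelic))) ∂ν) ∂μK := by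
  rw [← integral_const_mul]
  refine integral_congr_ae (Filter.Eventually.of_forall fun k => ?_)
  have hassoc : ∀ v : ↥(adelicUnipotent F E c 3),
      (quasiSplit F E c 3).toAdelic (weylLongU (c : E →+* E) (rfl : (StdForm.antidiagonal 3).over E = (StdForm.antidiagonal 3).over E)) * (v : (quasiSplit F E c 3).Adelic) *
          (((t : borelAdelic F E c 3) : (quasiSplit F E c 3).Adelic) * (k : (quasiSplit F E c 3).Adelic)) =
        (quasiSplit F E c 3).toAdelic (weylLongU (c : E →+* E) (rfl : (StdForm.antidiagonal 3).over E = (StdForm.antidiagonal 3).over E)) * ((v : (quasiSplit F E c 3).Adelic) *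
          (((t : borelAdelic F E c 3) : (quasiSplit F E c 3).Adelic) * (k : (quasiSplit F E c 3).Adelic))) := fun v => mul_assoc _ _ _
  simp_rw [hassoc]
  simp only [integral_comp_borelHeight_mul_weylLongU_torus_mul_eq_diagUnit hc hc1 ν hφ' hφ'm hf'm t, borelHeight_torus_mul_maximalCompact_three t k,
    apply_torus_mul_of_isChiSectionPair hφ t, Complex.real_smul, map_mul, Complex.conj_ofReal]
  ring

/-! ## §3 The middle-entry torus character: continuity, triviality on the rational torus, a witness on the fibre `ker d₀` -/

omit [MeasurableSpace (quasiSplit F E c 3).Adelic] [BorelSpace (quasiSplit F E c 3).Adelic] in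
/-- `t ↦ t₁₁ : T(𝔸_F) → U(1)(𝔸_F)` is continuous (the entry `diag t 1` is, ★ `continuous_diagUnit_torus`; `middleEntryUnitary` has the same underlying idele). [cite: Rogawski1990, §1.10 p. 9] -/
theorem continuous_middleEntryUnitary_torus : Continuous fun t : ↥(torusInBorel F E c 3) => (middleEntryUnitary (t : borelAdelic F E c 3).2 : ↥(TorusDict.torus c)) := by
  refine continuous_induced_rng.2 ?_
  have h : (fun t : ↥(torusInBorel F E c 3) => ((middleEntryUnitary (t : borelAdelic F E c 3).2 : ↥(TorusDict.torus c)) : ideleGroup E)) =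
      fun t : ↥(torusInBorel F E c 3) => diagUnit (t : borelAdelic F E c 3).2 1 := funext fun t => by
    rw [coe_middleEntryUnitary]; exact Units.ext rfl
  rw [show ((↑) : ↥(TorusDict.torus c) → ideleGroup E) ∘ (fun t : ↥(torusInBorel F E c 3) => (middleEntryUnitary (t : borelAdelic F E c 3).2 : ↥(TorusDict.torus c))) =
    fun t : ↥(torusInBorel F E c 3) => ((middleEntryUnitary (t : borelAdelic F E c 3).2 : ↥(TorusDict.torus c)) : ideleGroup E) from rfl, h]
  exact continuous_diagUnit_torus (F := F) (E := E) (c := c) 1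

omit [MeasurableSpace (quasiSplit F E c 3).Adelic] [BorelSpace (quasiSplit F E c 3).Adelic] in
/-- `t ↦ t₁₁` is multiplicative on `T(𝔸_F)` (★ `middleEntryUnitary_mul`, torus currency; twin of ★ `diagUnit_torus_mul`). [cite: Rogawski1990, §1.10 p. 9] -/
theorem middleEntryUnitary_torus_mul (t t' : ↥(torusInBorel F E c 3)) :
    middleEntryUnitary ((t * t' : ↥(torusInBorel F E c 3)) : borelAdelic F E c 3).2 = middleEntryUnitary (t : borelAdelic F E c 3).2 * middleEntryUnitary (t' : borelAdelic F E c 3).2 :=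
  middleEntryUnitary_mul (t : borelAdelic F E c 3).2 (t' : borelAdelic F E c 3).2

omit [MeasurableSpace (quasiSplit F E c 3).Adelic] [BorelSpace (quasiSplit F E c 3).Adelic] in
/-- **THE MIDDLE-ENTRY TORUS CHARACTER `η = (χ₂·conj χ₂′)∘(·)₁₁ : T(𝔸_F) →* ℂ`** of two `U(1)`-characters `χ₂, χ₂′`: a continuous homomorphism with `η(t) = χ₂(t₁₁)·conj χ₂′(t₁₁)` (★
`middleEntryUnitary_mul`; `conj` is multiplicative) — the torus character carried by BOTH `K_U`-averages of the (XF)₃ bracket (★ C1 §3, §2 above). [cite: Rogawski1990, §1.10 p. 9]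
[cite: MoeglinWaldspurger1995, II.2.1] -/
theorem exists_middleEntryChar (χ₂ χ₂' : ↥(TorusDict.torus c) →ₜ* ℂˣ) :
    ∃ η : ↥(torusInBorel F E c 3) →* ℂ, Continuous η ∧
      ∀ t : ↥(torusInBorel F E c 3), η t = ((χ₂ (middleEntryUnitary (t : borelAdelic F E c 3).2) : ℂˣ) : ℂ) * conj ((χ₂' (middleEntryUnitary (t : borelAdelic F E c 3).2) : ℂˣ) : ℂ) := by
  have hmul : ∀ t t' : ↥(torusInBorel F E c 3),
      ((χ₂ (middleEntryUnitary ((t * t' : ↥(torusInBorel F E c 3)) : borelAdelic F E c 3).2) : ℂˣ) : ℂ) * conj ((χ₂' (middleEntryUnitary ((t * t' : ↥(torusInBorel F E c 3)) : borelAdelic F E c 3).2) : ℂˣ) : ℂ) =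
        ((χ₂ (middleEntryUnitary (t : borelAdelic F E c 3).2) : ℂˣ) : ℂ) * conj ((χ₂' (middleEntryUnitary (t : borelAdelic F E c 3).2) : ℂˣ) : ℂ) *
          (((χ₂ (middleEntryUnitary (t' : borelAdelic F E c 3).2) : ℂˣ) : ℂ) * conj ((χ₂' (middleEntryUnitary (t' : borelAdelic F E c 3).2) : ℂˣ) : ℂ)) := fun t t' => by
    rw [middleEntryUnitary_torus_mul, map_mul, map_mul, Units.val_mul, Units.val_mul, map_mul]; ring
  have hone : ((χ₂ (middleEntryUnitary ((1 : ↥(torusInBorel F E c 3)) : borelAdelic F E c 3).2) : ℂˣ) : ℂ) * conj ((χ₂' (middleEntryUnitary ((1 : ↥(torusInBorel F E c 3)) : borelAdelic F E c 3).2) : ℂˣ) : ℂ) = 1 := by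
    have h1 : middleEntryUnitary ((1 : ↥(torusInBorel F E c 3)) : borelAdelic F E c 3).2 = 1 := by
      exact (middleEntryUnitary_eq_of_apply_eq _ (Subgroup.one_mem _) rfl).trans middleEntryUnitary_one
    simp only [h1, map_one, Units.val_one, mul_one]
  let η : ↥(torusInBorel F E c 3) →* ℂ :=
    ⟨⟨fun t : ↥(torusInBorel F E c 3) => ((χ₂ (middleEntryUnitary (t : borelAdelic F E c 3).2) : ℂˣ) : ℂ) * conj ((χ₂' (middleEntryUnitary (t : borelAdelic F E c 3).2) : ℂˣ) : ℂ), hone⟩, hmul⟩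
  refine ⟨η, ?_, fun t => rfl⟩
  exact ((Units.continuous_val.comp (map_continuous χ₂)).comp continuous_middleEntryUnitary_torus).mul
    (Complex.continuous_conj.comp ((Units.continuous_val.comp (map_continuous χ₂')).comp continuous_middleEntryUnitary_torus))

omit [MeasurableSpace (quasiSplit F E c 3).Adelic] [BorelSpace (quasiSplit F E c 3).Adelic] in
/-- **An AUTOMORPHIC `χ₂` is trivial on the middle entries of the RATIONAL torus `Γ_T = B(F) ∩ T(𝔸_F)`** (★ `apply_middleEntryUnitary_toAdelic_eq_one`). [cite: Rogawski1990, §1.9 p. 9] -/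
theorem apply_middleEntryUnitary_rationalTorus_eq_one {χ₂ : ↥(TorusDict.torus c) →ₜ* ℂˣ} (hχ₂ : TorusDict.IsAutomorphic c χ₂)
    (τ : ↥((rationalBorel F E c 3).subgroupOf (torusInBorel F E c 3))) :
    χ₂ (middleEntryUnitary (((τ : ↥(torusInBorel F E c 3)) : borelAdelic F E c 3)).2) = 1 := by
  obtain ⟨γ, hγ⟩ := (τ.2 : (((τ : ↥(torusInBorel F E c 3)) : borelAdelic F E c 3) : (quasiSplit F E c 3).Adelic) ∈ (quasiSplit F E c 3).arithmeticSubgroup)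
  have hγB : (quasiSplit F E c 3).toAdelic γ ∈ borelAdelic F E c 3 := by rw [hγ]; exact (((τ : ↥(torusInBorel F E c 3)) : borelAdelic F E c 3)).2
  rw [middleEntryUnitary_eq_of_apply_eq (((τ : ↥(torusInBorel F E c 3)) : borelAdelic F E c 3)).2 hγB (by rw [hγ]; rfl)]
  exact apply_middleEntryUnitary_toAdelic_eq_one hχ₂ γ hγB

omit [MeasurableSpace (quasiSplit F E c 3).Adelic] [BorelSpace (quasiSplit F E c 3).Adelic] in
/-- **THE FIBRE `ker d₀` SURJECTS ONTO `U(1)(𝔸_F)` BY `t ↦ t₁₁`**: for `c² = 1` and every `u ∈ U(1)(𝔸_F)` there is `s = diag(1, u, 1) ∈ T(𝔸_F)` with `d₀ s = 1` and `s₁₁ = u` (★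
`exists_torus_diagUnit_eq`, ★ `adelicOne = TorusDict.torus`). [cite: Rogawski1990, §1.10 p. 9] -/
theorem exists_torus_diagUnit_zero_eq_one_and_middleEntryUnitary_eq (hc : c * c = 1) (u : ↥(TorusDict.torus c)) :
    ∃ s : ↥(torusInBorel F E c 3), diagUnit (s : borelAdelic F E c 3).2 0 = 1 ∧ middleEntryUnitary (s : borelAdelic F E c 3).2 = u := by
  have hu : conjAdele F E c ((u : ideleGroup E) : AdeleRing (𝓞 E) E) * (u : ideleGroup E) = 1 :=
    (mem_adelicOne_iff F E c _).1 ((mem_adelicOne_iff_mem_torus F E c _).2 u.2)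
  obtain ⟨s, -, h0, h1⟩ := exists_torus_diagUnit_eq (F := F) hc 1 (u : ideleGroup E) hu
  refine ⟨s, h0, Subtype.ext ?_⟩
  rw [coe_middleEntryUnitary, ← h1]
  exact Units.ext rfl

/-! ## §4 The radial finiteness on `𝓕_I` at `N = 3`: `∫⁻_𝓕 (‖x‖·‖x‖)⁻¹·|f(‖x‖)|·D dν_I < ∞` for `f ∈ C_c((0,∞))` -/

omit [MeasurableSpace (quasiSplit F E c 3).Adelic] [BorelSpace (quasiSplit F E c 3).Adelic] in
/-- **`∫⁻_{𝓕} (‖x‖·‖x‖)⁻¹ · ‖f(‖x‖)‖ · D dν_I < ∞`** for a continuous `f` with compact support in `(0,∞)`, a constant `D < ∞`, `ν_I` Haar on `𝕀_E` and an idele class domain `𝓕` — the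
finiteness input of ★ (δ)₃ ∕ C3′ for the radial majorants of (XF)₃: on `supp f∘‖·‖` one has `‖x‖ ≥ T⁻¹` (★ D0 `exists_one_le_forall_eq_zero`), so `(‖x‖²)⁻¹ ≤ T·‖x‖⁻¹`; then ★ C
`setLIntegral_inv_ideleNorm_mul_comp_eq` and ★ Final §1. [cite: TateThesis1967, Thm. 4.3.2] [cite: MoeglinWaldspurger1995, II.1.2] -/
theorem setLIntegral_normSq_inv_mul_enorm_comp_lt_top [MeasurableSpace (AdeleRing (𝓞 E) E)ˣ] [BorelSpace (AdeleRing (𝓞 E) E)ˣ]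
    (νI : Measure (AdeleRing (𝓞 E) E)ˣ) [νI.IsHaarMeasure] {𝓕 : Set (AdeleRing (𝓞 E) E)ˣ} (h𝓕 : IsIdeleClassDomain E 𝓕)
    {f : ℝ → ℂ} (hfc : Continuous f) (hfs : HasCompactSupport f) (hf0 : tsupport f ⊆ Set.Ioi 0) {D : ℝ≥0∞} (hD : D ≠ ∞) :
    ∫⁻ x in 𝓕, (((IdeleClassGroup.ideleNorm E x * IdeleClassGroup.ideleNorm E x)⁻¹ : ℝ≥0) : ℝ≥0∞) * (‖f (IdeleClassGroup.ideleNorm E x : ℝ)‖ₑ * D) ∂νI < ∞ := by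
  haveI := t2Space_adeleRing_of_numberField E
  haveI := locallyCompactSpace_adeleRing' E
  obtain ⟨T, hT, -, hlo⟩ := exists_one_le_forall_eq_zero hfs hf0
  have hT0 : (0 : ℝ≥0) < T := one_pos.trans_le hT
  have hpt : ∀ x : (AdeleRing (𝓞 E) E)ˣ, (((IdeleClassGroup.ideleNorm E x * IdeleClassGroup.ideleNorm E x)⁻¹ : ℝ≥0) : ℝ≥0∞) * (‖f (IdeleClassGroup.ideleNorm E x : ℝ)‖ₑ * D) ≤
      (((IdeleClassGroup.ideleNorm E x)⁻¹ : ℝ≥0) : ℝ≥0∞) * (‖f (IdeleClassGroup.ideleNorm E x : ℝ)‖ₑ * ((T : ℝ≥0∞) * D)) := by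
    intro x
    by_cases hx : f (IdeleClassGroup.ideleNorm E x : ℝ) = 0
    · simp only [hx, enorm_zero, zero_mul, mul_zero, le_refl]
    · have hTr : (T : ℝ≥0)⁻¹ ≤ IdeleClassGroup.ideleNorm E x := by
        rw [← NNReal.coe_le_coe, NNReal.coe_inv]; exact not_lt.1 fun h => hx (hlo _ h)
      have hinv : (IdeleClassGroup.ideleNorm E x)⁻¹ ≤ T := inv_le_of_inv_le₀ hT0 hTr
      calc (((IdeleClassGroup.ideleNorm E x * IdeleClassGroup.ideleNorm E x)⁻¹ : ℝ≥0) : ℝ≥0∞) * (‖f (IdeleClassGroup.ideleNorm E x : ℝ)‖ₑ * D)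
          = (((IdeleClassGroup.ideleNorm E x)⁻¹ : ℝ≥0) : ℝ≥0∞) * (‖f (IdeleClassGroup.ideleNorm E x : ℝ)‖ₑ * ((((IdeleClassGroup.ideleNorm E x)⁻¹ : ℝ≥0) : ℝ≥0∞) * D)) := by
            rw [mul_inv, ENNReal.coe_mul]; ring
        _ ≤ (((IdeleClassGroup.ideleNorm E x)⁻¹ : ℝ≥0) : ℝ≥0∞) * (‖f (IdeleClassGroup.ideleNorm E x : ℝ)‖ₑ * ((T : ℝ≥0∞) * D)) := by gcongr
  refine lt_of_le_of_lt (lintegral_mono hpt) ?_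
  rw [setLIntegral_inv_ideleNorm_mul_comp_eq νI h𝓕 (Gm := fun r => ‖f r‖ₑ * ((T : ℝ≥0∞) * D)) (hfc.measurable.enorm.mul_const _)]
  exact ENNReal.mul_lt_top (idelicCovolume_ne_top νI).lt_top (setLIntegral_inv_mul_inv_mul_enorm_lt_top hfc hfs hf0 (ENNReal.mul_ne_top ENNReal.coe_ne_top hD))

/-! ## §5 The CM pair `(L⁺, L, conj)`: a UNIFORM bound of the rescaled `w₀`-cell `∫_{N(𝔸)} f′(a⁻¹H(W v k))·φ′(W v k) dν` on `T⁻¹ ≤ a`, `k ∈ K_U` -/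

section CM

variable (L : Type) [Field L] [NumberField L] [IsCMField L]
variable [MeasurableSpace (quasiSplit (↥(maximalRealSubfield L)) L (IsCMField.complexConj L) 3).Adelic] [BorelSpace (quasiSplit (↥(maximalRealSubfield L)) L (IsCMField.complexConj L) 3).Adelic]

/-- **UNIFORM BOUND OF THE RESCALED `w₀`-CELL** (`U(2,1)_{L∕L⁺}`): for `f′ ∈ C_c((0,∞))` (cut-off `T′`: `f′ = 0` off `[T′⁻¹, T′]`), any `φ′` with `‖φ′‖ ≤ C_{φ′}`, and `T ≥ 1`, there is
`D ≥ 0` with **`‖∫_{N(𝔸)} f′(a⁻¹·H(W v k))·φ′(W v k) dν(v)‖ ≤ D`** for all `a ≥ T⁻¹` in `ℝ≥0` and all `k ∈ K_U`: on the support `a⁻¹H ≥ T′⁻¹`, so `1 ≤ (T′·T·H(W v k))³`, and `H(W v k) = H(W v)`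
(`K_U`-invariance ★), whence the integrand is majorised by `‖f′‖_∞·C_{φ′}·(T′T)³·H(W v)³`, integrable by Godement (★ `integrable_borelHeight_weylLongU_mul_rpow_cm_three`, `σ = 3 > 2`).
[cite: MoeglinWaldspurger1995, II.1.5] [cite: Garrett2018, §2.8] -/
theorem exists_bound_integral_comp_borelHeight_mul_weylLongU_cm_three (ν : Measure ↥(adelicUnipotent (↥(maximalRealSubfield L)) L (IsCMField.complexConj L) 3)) [ν.IsHaarMeasure] [ν.IsInvInvariant]
    {𝓕 : Set ↥(adelicUnipotent (↥(maximalRealSubfield L)) L (IsCMField.complexConj L) 3)}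
    (h𝓕N : IsFundamentalDomain ↥(rationalUnipotent (↥(maximalRealSubfield L)) L (IsCMField.complexConj L) 3) 𝓕 ν) (h𝓕c : IsCompact (closure 𝓕))
    {f' : ℝ → ℂ} (hf'c : Continuous f') (hf's : HasCompactSupport f') (hf'0 : tsupport f' ⊆ Set.Ioi 0)
    {φ' : (quasiSplit (↥(maximalRealSubfield L)) L (IsCMField.complexConj L) 3).Adelic → ℂ} {Cφ' : ℝ} (hφ'C : ∀ x, ‖φ' x‖ ≤ Cφ') {T : ℝ≥0} (hT : 1 ≤ T) :
    ∃ D : ℝ, 0 ≤ D ∧ ∀ a : ℝ≥0, T⁻¹ ≤ a →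
      ∀ k : ((standardMaximalCompactGL 3 L).comap (adelicVal (↥(maximalRealSubfield L)) L (IsCMField.complexConj L) 3 ((StdForm.antidiagonal 3).over L)) : Subgroup (quasiSplit (↥(maximalRealSubfield L)) L (IsCMField.complexConj L) 3).Adelic),
        ‖∫ v : ↥(adelicUnipotent (↥(maximalRealSubfield L)) L (IsCMField.complexConj L) 3),
            f' ((((a⁻¹ * borelHeight ((quasiSplit (↥(maximalRealSubfield L)) L (IsCMField.complexConj L) 3).toAdelic (weylLongU ((IsCMField.complexConj L : L ≃ₐ[↥(maximalRealSubfield L)] L) : L →+* L) (rfl : (StdForm.antidiagonal 3).over L = (StdForm.antidiagonal 3).over L)) *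
                ((v : (quasiSplit (↥(maximalRealSubfield L)) L (IsCMField.complexConj L) 3).Adelic) * (k : (quasiSplit (↥(maximalRealSubfield L)) L (IsCMField.complexConj L) 3).Adelic)))) : ℝ≥0) : ℝ)) *
              φ' ((quasiSplit (↥(maximalRealSubfield L)) L (IsCMField.complexConj L) 3).toAdelic (weylLongU ((IsCMField.complexConj L : L ≃ₐ[↥(maximalRealSubfield L)] L) : L →+* L) (rfl : (StdForm.antidiagonal 3).over L = (StdForm.antidiagonal 3).over L)) *
                ((v : (quasiSplit (↥(maximalRealSubfield L)) L (IsCMField.complexConj L) 3).Adelic) * (k : (quasiSplit (↥(maximalRealSubfield L)) L (IsCMField.complexConj L) 3).Adelic))) ∂ν‖ ≤ D := by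
  obtain ⟨T', hT', hhi', hlo'⟩ := exists_one_le_forall_eq_zero hf's hf'0
  obtain ⟨B', hB'⟩ := hf's.exists_bound_of_continuous hf'c
  have hB'0 : 0 ≤ B' := (norm_nonneg _).trans (hB' 1)
  have hCφ' : 0 ≤ Cφ' := (norm_nonneg _).trans (hφ'C 1)
  have hT0 : (0 : ℝ≥0) < T := one_pos.trans_le hT
  have hT'0 : (0 : ℝ) < T' := by exact_mod_cast one_pos.trans_le hT'
  set W : (quasiSplit (↥(maximalRealSubfield L)) L (IsCMField.complexConj L) 3).Adelic :=
    (quasiSplit (↥(maximalRealSubfield L)) L (IsCMField.complexConj L) 3).toAdelic (weylLongU ((IsCMField.complexConj L : L ≃ₐ[↥(maximalRealSubfield L)] L) : L →+* L) (rfl : (StdForm.antidiagonal 3).over L = (StdForm.antidiagonal 3).over L)) with hW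
  -- `c₀ = ∫ H(W v)³ dν`, finite by Godement (★, `σ = 3 > 2`)
  have hint := integrable_borelHeight_weylLongU_mul_rpow_cm_three L ν h𝓕N h𝓕c (σ := 3) (by norm_num) 1
  simp only [mul_one] at hint
  refine ⟨B' * Cφ' * ((T' : ℝ) * T) ^ (3 : ℝ) * ∫ v : ↥(adelicUnipotent (↥(maximalRealSubfield L)) L (IsCMField.complexConj L) 3), (borelHeight (W * (v : (quasiSplit (↥(maximalRealSubfield L)) L (IsCMField.complexConj L) 3).Adelic)) : ℝ) ^ (3 : ℝ) ∂ν,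
    mul_nonneg (mul_nonneg (mul_nonneg hB'0 hCφ') (Real.rpow_nonneg (by positivity) _)) (integral_nonneg fun _ => Real.rpow_nonneg (NNReal.coe_nonneg _) _), fun a ha k => ?_⟩
  have ha0 : (0 : ℝ≥0) < a := (inv_pos.2 hT0).trans_le ha
  have hK : ∀ v : ↥(adelicUnipotent (↥(maximalRealSubfield L)) L (IsCMField.complexConj L) 3),
      borelHeight (W * ((v : (quasiSplit (↥(maximalRealSubfield L)) L (IsCMField.complexConj L) 3).Adelic) * (k : (quasiSplit (↥(maximalRealSubfield L)) L (IsCMField.complexConj L) 3).Adelic))) =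
        borelHeight (W * (v : (quasiSplit (↥(maximalRealSubfield L)) L (IsCMField.complexConj L) 3).Adelic)) := fun v => by
    rw [← mul_assoc, borelHeight_mul_of_mem_comap_standardMaximalCompactGL k.2]
  rw [← integral_const_mul]
  refine norm_integral_le_of_norm_le (hint.const_mul _) (ae_of_all _ fun v => ?_)
  rw [hK v, norm_mul]
  have hpos : 0 ≤ B' * Cφ' * ((T' : ℝ) * T) ^ (3 : ℝ) := mul_nonneg (mul_nonneg hB'0 hCφ') (Real.rpow_nonneg (by positivity) _)
  by_cases hz : f' (((a⁻¹ * borelHeight (W * (v : (quasiSplit (↥(maximalRealSubfield L)) L (IsCMField.complexConj L) 3).Adelic)) : ℝ≥0) : ℝ)) = 0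
  · rw [hz, norm_zero, zero_mul]
    exact mul_nonneg hpos (Real.rpow_nonneg (NNReal.coe_nonneg _) _)
  · -- on the support: `T′⁻¹ ≤ a⁻¹ H`, so `1 ≤ T′·T·H ≤ (T′·T·H)³`
    have hlow : (T' : ℝ)⁻¹ ≤ ((a⁻¹ * borelHeight (W * (v : (quasiSplit (↥(maximalRealSubfield L)) L (IsCMField.complexConj L) 3).Adelic)) : ℝ≥0) : ℝ) := not_lt.1 fun h => hz (hlo' _ h)
    have hainv : ((a⁻¹ : ℝ≥0) : ℝ) ≤ T := by
      rw [NNReal.coe_inv, inv_le_comm₀ (NNReal.coe_pos.2 ha0) (NNReal.coe_pos.2 hT0), ← NNReal.coe_inv]; exact NNReal.coe_le_coe.2 ha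
    have h1 : (1 : ℝ) ≤ (T' : ℝ) * T * (borelHeight (W * (v : (quasiSplit (↥(maximalRealSubfield L)) L (IsCMField.complexConj L) 3).Adelic)) : ℝ) := by
      rw [NNReal.coe_mul, inv_le_iff_one_le_mul₀ hT'0] at hlow
      calc (1 : ℝ) ≤ ((a⁻¹ : ℝ≥0) : ℝ) * (borelHeight (W * (v : (quasiSplit (↥(maximalRealSubfield L)) L (IsCMField.complexConj L) 3).Adelic)) : ℝ) * T' := hlow
        _ = (T' : ℝ) * ((a⁻¹ : ℝ≥0) : ℝ) * (borelHeight (W * (v : (quasiSplit (↥(maximalRealSubfield L)) L (IsCMField.complexConj L) 3).Adelic)) : ℝ) := by ring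
        _ ≤ (T' : ℝ) * T * (borelHeight (W * (v : (quasiSplit (↥(maximalRealSubfield L)) L (IsCMField.complexConj L) 3).Adelic)) : ℝ) := by gcongr
    have h3 : (1 : ℝ) ≤ ((T' : ℝ) * T) ^ (3 : ℝ) * (borelHeight (W * (v : (quasiSplit (↥(maximalRealSubfield L)) L (IsCMField.complexConj L) 3).Adelic)) : ℝ) ^ (3 : ℝ) := by
      rw [← Real.mul_rpow (by positivity) (NNReal.coe_nonneg _)]; exact Real.one_le_rpow h1 (by norm_num)
    calc ‖f' (((a⁻¹ * borelHeight (W * (v : (quasiSplit (↥(maximalRealSubfield L)) L (IsCMField.complexConj L) 3).Adelic)) : ℝ≥0) : ℝ))‖ *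
          ‖φ' (W * ((v : (quasiSplit (↥(maximalRealSubfield L)) L (IsCMField.complexConj L) 3).Adelic) * (k : (quasiSplit (↥(maximalRealSubfield L)) L (IsCMField.complexConj L) 3).Adelic)))‖
        ≤ B' * Cφ' := mul_le_mul (hB' _) (hφ'C _) (norm_nonneg _) hB'0
      _ = B' * Cφ' * 1 := (mul_one _).symm
      _ ≤ B' * Cφ' * (((T' : ℝ) * T) ^ (3 : ℝ) * (borelHeight (W * (v : (quasiSplit (↥(maximalRealSubfield L)) L (IsCMField.complexConj L) 3).Adelic)) : ℝ) ^ (3 : ℝ)) := by gcongr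
      _ = B' * Cφ' * ((T' : ℝ) * T) ^ (3 : ℝ) * (borelHeight (W * (v : (quasiSplit (↥(maximalRealSubfield L)) L (IsCMField.complexConj L) 3).Adelic)) : ℝ) ^ (3 : ℝ) := by ring

end CM

end Summit.HodgeConjecture.HodgeConjecture.Cruxes.H413.K2E1ChiPseudoEisensteinIdeleSplitCMThree

end
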